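import Summits.NavierStokesRegularity.NavierStokesRegularity.Theorems.PoloidalWindowDoorPoloidalWindowRigidityZShockNoLocalizedBreatherTools
import HarnessLib

/-!
# Crux K2 `PoloidalWindowRigidity` (stmt-NavierStokesRegularity-19708), line `z_shock` — NO HORIZONTALLY LOCALISED BREATHERS on a hyperbolic
# autonomous column: a height-periodic pattern of finite horizontal energy is horizontally frozen

`--supports stmt-NavierStokesRegularity-19708 --as helper` (leafhand-ns-poloidalwindowdoor-3 g11, cell decomp-ns, 2026-08-31).  Def-free; sequel of
`…ZShockVirialLaw` (p833222), `…ZShockPeriodicVirial` (p833370), `…ZShockBreatherBound` (this seat).  **No stub and no summit is closed by this file;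
Navier–Stokes regularity is NOT proved here (rung 0).**

★ `no_localized_breather` — let `(u, w)` be jointly smooth on `ℝ_s × ℝ²_y` and obey the autonomous height-evolution of the card
(`∂ₛuᵢ = G(w)∂ᵢw`, `∂ₛw = −(∂₀u₀ + ∂₁u₁)`, `∂₁u₀ = ∂₀u₁`) on a UNIFORMLY HYPERBOLIC column `−γhi ≤ G ≤ −γlo < 0` (slope `G = Γ'`; `Θ` the centred
virial potential, `Θ(w⋆) = 0`, `Θ' = (· − w⋆)G`, any smooth choice).  If the pattern is `P`-PERIODIC in the height (`P > 0`) and HORIZONTALLY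
LOCALISED around the level `w⋆` — `∫ (|u|² + (w − w⋆)²)(s, y) dy ≤ B` for every height `s` — then `w ≡ w⋆` (and consequently `∂ₛu ≡ 0`,
`div u = curl u = 0`: the pattern is a height-independent harmonic gradient field, `no_localized_breather_frozen`).

Proof (all ingredients in the tree): the breather bound `∫₀ᴾ∫χ_a γlo(w−w⋆)² ≤ ∫₀ᴾ∫|χ_a'|⟨y⟩(³⁄₂|u|² + (γhi/2)(w−w⋆)²)` (p833514) for the radii
`a_k = a' + 2k + 1`; the shell weight is dominated by `L(a_k + 1)(χ_{a_k+1} − χ_{a_k−1})` (`L = sup|smoothTransition'|`,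
`…NoLocalizedBreatherTools.abs_deriv_profile_mul_le`); the brackets `χ_{a'+2k+2} − χ_{a'+2k}` telescope, so the shell energies `h_k` have bounded partial sums
(`≤ (3/2 + γhi/2)·P·B`); hence `(a_k + 1)h_k < ε` for some `k` (`…Tools.exists_small_weighted_term`, divergence of the harmonic series); the left side is
monotone in the radius, so `∫₀ᴾ∫χ_{a'} γlo (w − w⋆)² = 0` for every `a'`, and continuity extracts `w = w⋆` pointwise; periodicity carries it to all
heights.

READING FOR THE LINE.  Hyperbolicity alone is used: the breather door does not separate the THICK column from (TH) (for the linear column this is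
Rellich's theorem — the Helmholtz equation has no `L²(ℝ²)` eigenfunctions — in disguise).  What it removes from the R3 inhabitant census (card
`Lines/z_shock.md`, §Instrument row «separable / radial-in-xₕ / two-phase ansätze»): every candidate that is periodic in the height and of finite
horizontal energy about some level.  Surviving candidates must radiate: `∫(|u|² + (w−w⋆)²) dy = ∞` at some height for EVERY level `w⋆` (as the
rotating Bessel witness of `…ZShockRotatingProfileLinearWitness` does: amplitude `≍ r^{-1/2}`).  Honest scope: M-sized; kinematic; no NS. [folklore]
-/

noncomputable section

namespace Summit.NavierStokesRegularity.NavierStokesRegularity.Theorems.PoloidalWindowDoorPoloidalWindowRigidityZShockNoLocalizedBreather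

-- the summit and its single sub-problem share the name (CONVENTIONS §1)
set_option linter.dupNamespace false

open Set Filter Topology Function MeasureTheory Metric
open scoped ContDiff
open Literature.Analysis.FluidPDE (continuousOn_integral_of_support_subset)
open Summit.NavierStokesRegularity.NavierStokesRegularity.Theorems.PoloidalWindowDoorPoloidalWindowRigidityZShockVirialLaw
open Summit.NavierStokesRegularity.NavierStokesRegularity.Theorems.PoloidalWindowDoorPoloidalWindowRigidityZShockLocalEnergyCutoff
open Summit.NavierStokesRegularity.NavierStokesRegularity.Theorems.PoloidalWindowDoorPoloidalWindowRigidityZShockLocalEnergy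
open Summit.NavierStokesRegularity.NavierStokesRegularity.Theorems.PoloidalWindowDoorPoloidalWindowRigidityZShockPeriodicVirial
open Summit.NavierStokesRegularity.NavierStokesRegularity.Theorems.PoloidalWindowDoorPoloidalWindowRigidityZShockBreatherBound
open Summit.NavierStokesRegularity.NavierStokesRegularity.Theorems.PoloidalWindowDoorPoloidalWindowRigidityZShockNoLocalizedBreatherTools

/-! ### The theorem -/

variable {u : Fin 2 → ℝ → EuclideanSpace ℝ (Fin 2) → ℝ} {w : ℝ → EuclideanSpace ℝ (Fin 2) → ℝ} {G Θ : ℝ → ℝ} {wstar P γlo γhi B : ℝ}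

/-- ★ **No horizontally localised breathers** (hypotheses in the module docstring): `w ≡ w⋆`. [folklore] -/
theorem no_localized_breather (hu : ∀ i, ContDiff ℝ ∞ (uncurry (u i))) (hw : ContDiff ℝ ∞ (uncurry w))
    (hΘs : ContDiff ℝ ∞ Θ) (hΘ : ∀ r, HasDerivAt Θ ((r - wstar) * G r) r) (hΘ0 : Θ wstar = 0)
    (hγlo : 0 < γlo) (hGlo : ∀ r, G r ≤ -γlo) (hGhi : ∀ r, -γhi ≤ G r)
    (hus : ∀ i s y, HasDerivAt (fun s' => u i s' y) (G (w s y) * fderiv ℝ (w s) y (EuclideanSpace.single i 1)) s)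
    (hws : ∀ s y, HasDerivAt (fun s' => w s' y)
      (-(fderiv ℝ (u 0 s) y (EuclideanSpace.single 0 1) + fderiv ℝ (u 1 s) y (EuclideanSpace.single 1 1))) s)
    (hpol : ∀ s y, fderiv ℝ (u 0 s) y (EuclideanSpace.single 1 1) = fderiv ℝ (u 1 s) y (EuclideanSpace.single 0 1))
    (hP : 0 < P) (hPu : ∀ i s y, u i (s + P) y = u i s y) (hPw : ∀ s y, w (s + P) y = w s y)
    (hint : ∀ s, Integrable fun y => u 0 s y ^ 2 + u 1 s y ^ 2 + (w s y - wstar) ^ 2)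
    (hB : ∀ s, ∫ y, (u 0 s y ^ 2 + u 1 s y ^ 2 + (w s y - wstar) ^ 2) ≤ B) :
    ∀ s y, w s y = wstar := by
  have hγhi : 0 ≤ γhi := by linarith [hGlo 0, hGhi 0]
  obtain ⟨L, hL0, hL⟩ := exists_deriv_profile_bound
  -- the energy density `K` and the defect density
  set K : ℝ → EuclideanSpace ℝ (Fin 2) → ℝ := fun s y =>
    (3 / 2) * (u 0 s y ^ 2 + u 1 s y ^ 2) + (γhi / 2) * (w s y - wstar) ^ 2 with hK_def
  set Dd : ℝ → EuclideanSpace ℝ (Fin 2) → ℝ := fun s y => γlo * (w s y - wstar) ^ 2 with hDd_def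
  have hu2 : ContDiff ℝ ∞ (uncurry fun s (y : EuclideanSpace ℝ (Fin 2)) => u 0 s y ^ 2 + u 1 s y ^ 2) :=
    ((hu 0).pow 2).add ((hu 1).pow 2)
  have hd2 : ContDiff ℝ ∞ (uncurry fun s (y : EuclideanSpace ℝ (Fin 2)) => (w s y - wstar) ^ 2) :=
    (hw.sub contDiff_const).pow 2
  have hKc : Continuous (uncurry K) := (continuous_const.mul hu2.continuous).add (continuous_const.mul hd2.continuous)
  have hDdc : Continuous (uncurry Dd) := continuous_const.mul hd2.continuous
  have hK0 : ∀ s y, 0 ≤ K s y := fun s y => by simp only [hK_def]; positivity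
  have hDd0 : ∀ s y, 0 ≤ Dd s y := fun s y => by simp only [hDd_def]; positivity
  -- `∫ K(s, ·) ≤ C₀ B`
  have hKle : ∀ s y, K s y ≤ (3 / 2 + γhi / 2) * (u 0 s y ^ 2 + u 1 s y ^ 2 + (w s y - wstar) ^ 2) := by
    intro s y
    simp only [hK_def]
    nlinarith [sq_nonneg (u 0 s y), sq_nonneg (u 1 s y), sq_nonneg (w s y - wstar)]
  have hKint : ∀ s, Integrable (K s) := fun s =>
    (((hint s).const_mul (3 / 2 + γhi / 2)).mono' (hKc.comp (Continuous.prodMk_right s)).aestronglyMeasurable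
      (Eventually.of_forall fun y => by
        rw [Real.norm_eq_abs, abs_of_nonneg (hK0 s y)]; exact hKle s y))
  have hKB : ∀ s, ∫ y, K s y ≤ (3 / 2 + γhi / 2) * B := fun s =>
    calc ∫ y, K s y ≤ ∫ y, (3 / 2 + γhi / 2) * (u 0 s y ^ 2 + u 1 s y ^ 2 + (w s y - wstar) ^ 2) :=
          integral_mono (hKint s) ((hint s).const_mul _) (hKle s)
      _ = (3 / 2 + γhi / 2) * ∫ y, (u 0 s y ^ 2 + u 1 s y ^ 2 + (w s y - wstar) ^ 2) := integral_const_mul _ _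
      _ ≤ (3 / 2 + γhi / 2) * B := mul_le_mul_of_nonneg_left (hB s) (by positivity)
  -- STEP A: for every `a' ≥ 0`, the cut-off defect over one period vanishes
  have stepA : ∀ a' : ℝ, 0 ≤ a' →
      ∫ s in (0 : ℝ)..P, ∫ y, Real.smoothTransition (a' + 1 - √(1 + ‖y‖ ^ 2)) * Dd s y = 0 := by
    intro a' ha'
    -- the cut-off defect as a function of the radius
    set J : ℝ → ℝ := fun a => ∫ s in (0 : ℝ)..P, ∫ y, Real.smoothTransition (a + 1 - √(1 + ‖y‖ ^ 2)) * Dd s y with hJ_def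
    have hJc : ∀ a, Continuous fun s => ∫ y, Real.smoothTransition (a + 1 - √(1 + ‖y‖ ^ 2)) * Dd s y := fun a =>
      continuous_weighted hDdc (continuous_cutoff a) (cutoff_zero_of_lt a)
    have hJ0 : 0 ≤ J a' :=
      intervalIntegral.integral_nonneg hP.le fun s _ =>
        integral_nonneg fun y => mul_nonneg (Real.smoothTransition.nonneg _) (hDd0 s y)
    -- monotonicity in the radius
    have hJmono : ∀ a, a' ≤ a → J a' ≤ J a := by
      intro a haa
      refine intervalIntegral.integral_mono_on hP.le ((hJc a').intervalIntegrable _ _) ((hJc a).intervalIntegrable _ _)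
        fun s _ => integral_mono (integrable_weighted hDdc (continuous_cutoff a') (cutoff_zero_of_lt a') s)
          (integrable_weighted hDdc (continuous_cutoff a) (cutoff_zero_of_lt a) s) fun y => ?_
      exact mul_le_mul_of_nonneg_right (Real.smoothTransition.monotone (by linarith)) (hDd0 s y)
    -- the breather bound at radius `a ≥ 0`, with the shell domination: `J a ≤ L (a+1) ∫₀ᴾ∫ (χ_{a+1} − χ_{a−1}) K`
    have hJle : ∀ a, 0 ≤ a → J a ≤ L * (a + 1) * ∫ s in (0 : ℝ)..P, ∫ y,
        (Real.smoothTransition (a + 2 - √(1 + ‖y‖ ^ 2)) - Real.smoothTransition (a - √(1 + ‖y‖ ^ 2))) * K s y := by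
      intro a ha
      have hPV := periodic_virial_le hu hw hΘs hΘ hΘ0 hγlo.le hGlo hGhi hus hws hpol hP.le hPu hPw a
      simp only [zero_mul, add_zero] at hPV
      -- the shell weight and its domination
      have hρc : Continuous fun y : EuclideanSpace ℝ (Fin 2) =>
          Real.smoothTransition (a + 2 - √(1 + ‖y‖ ^ 2)) - Real.smoothTransition (a - √(1 + ‖y‖ ^ 2)) := by
        have h1 := continuous_cutoff (a + 1)
        have h2 := continuous_cutoff (a - 1)
        simp only [sub_add_cancel] at h2
        exact (h1.congr fun y => by ring_nf).sub h2
      have hρ0 : ∀ y : EuclideanSpace ℝ (Fin 2), a + 2 < ‖y‖ →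
          Real.smoothTransition (a + 2 - √(1 + ‖y‖ ^ 2)) - Real.smoothTransition (a - √(1 + ‖y‖ ^ 2)) = 0 := by
        intro y hy
        have hb := norm_le_bracket y
        rw [Real.smoothTransition.zero_of_nonpos (by linarith), Real.smoothTransition.zero_of_nonpos (by linarith), sub_zero]
      have hσc : Continuous fun y : EuclideanSpace ℝ (Fin 2) =>
          |deriv (fun v : ℝ => Real.smoothTransition (a + 1 - v)) (√(1 + ‖y‖ ^ 2))| * √(1 + ‖y‖ ^ 2) := by
        have h := continuous_deriv_cutoff (n := 2) a 0 0
        simp only [mul_zero, add_zero] at h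
        exact h.abs.mul (contDiff_bracket (k := 0)).continuous
      have hσ0 : ∀ y : EuclideanSpace ℝ (Fin 2), a + 1 < ‖y‖ →
          |deriv (fun v : ℝ => Real.smoothTransition (a + 1 - v)) (√(1 + ‖y‖ ^ 2))| * √(1 + ‖y‖ ^ 2) = 0 := by
        intro y hy
        rw [deriv_profile_eq_zero (by linarith [norm_le_bracket y]), abs_zero, zero_mul]
      -- pointwise in the height
      have hRle : ∀ s, ∫ y, |deriv (fun v : ℝ => Real.smoothTransition (a + 1 - v)) (√(1 + ‖y‖ ^ 2))| *
            (√(1 + ‖y‖ ^ 2) * K s y) ≤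
          L * (a + 1) * ∫ y, (Real.smoothTransition (a + 2 - √(1 + ‖y‖ ^ 2)) - Real.smoothTransition (a - √(1 + ‖y‖ ^ 2))) * K s y := by
        intro s
        rw [← integral_const_mul]
        have hi1 := integrable_weighted hKc hσc hσ0 s
        have hi2 := (integrable_weighted hKc hρc hρ0 s).const_mul (L * (a + 1))
        refine integral_mono (hi1.congr (Eventually.of_forall fun y => by simp only; ring)) hi2 fun y => ?_
        have hdom := abs_deriv_profile_mul_le hL0 hL ha (bracket_pos y).le
        have hk := hK0 s y
        calc |deriv (fun v : ℝ => Real.smoothTransition (a + 1 - v)) (√(1 + ‖y‖ ^ 2))| * (√(1 + ‖y‖ ^ 2) * K s y)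
            = (|deriv (fun v : ℝ => Real.smoothTransition (a + 1 - v)) (√(1 + ‖y‖ ^ 2))| * √(1 + ‖y‖ ^ 2)) * K s y := by ring
          _ ≤ (L * (a + 1) * (Real.smoothTransition (a + 2 - √(1 + ‖y‖ ^ 2)) - Real.smoothTransition (a - √(1 + ‖y‖ ^ 2)))) * K s y :=
              mul_le_mul_of_nonneg_right hdom hk
          _ = L * (a + 1) * ((Real.smoothTransition (a + 2 - √(1 + ‖y‖ ^ 2)) - Real.smoothTransition (a - √(1 + ‖y‖ ^ 2))) * K s y) := by
              ring
      have hRc : Continuous fun s => ∫ y, |deriv (fun v : ℝ => Real.smoothTransition (a + 1 - v)) (√(1 + ‖y‖ ^ 2))| *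
          (√(1 + ‖y‖ ^ 2) * K s y) := by
        have h := continuous_weighted hKc hσc hσ0
        refine h.congr fun s => integral_congr_ae (Eventually.of_forall fun y => ?_)
        simp only; ring
      have hHc : Continuous fun s => ∫ y, (Real.smoothTransition (a + 2 - √(1 + ‖y‖ ^ 2)) -
          Real.smoothTransition (a - √(1 + ‖y‖ ^ 2))) * K s y := continuous_weighted hKc hρc hρ0
      calc J a ≤ ∫ s in (0 : ℝ)..P, ∫ y, |deriv (fun v : ℝ => Real.smoothTransition (a + 1 - v)) (√(1 + ‖y‖ ^ 2))| *
              (√(1 + ‖y‖ ^ 2) * K s y) := hPV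
        _ ≤ ∫ s in (0 : ℝ)..P, L * (a + 1) * ∫ y, (Real.smoothTransition (a + 2 - √(1 + ‖y‖ ^ 2)) -
              Real.smoothTransition (a - √(1 + ‖y‖ ^ 2))) * K s y :=
            intervalIntegral.integral_mono_on hP.le (hRc.intervalIntegrable _ _) ((hHc.const_mul _).intervalIntegrable _ _)
              fun s _ => hRle s
        _ = L * (a + 1) * ∫ s in (0 : ℝ)..P, ∫ y, (Real.smoothTransition (a + 2 - √(1 + ‖y‖ ^ 2)) -
              Real.smoothTransition (a - √(1 + ‖y‖ ^ 2))) * K s y := intervalIntegral.integral_const_mul _ _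
    -- the shell energies along the radii `a_k = a' + 2k + 1` and their bounded partial sums (telescoping)
    set c : ℕ → EuclideanSpace ℝ (Fin 2) → ℝ := fun k y => Real.smoothTransition (a' + 2 * k + 1 - √(1 + ‖y‖ ^ 2)) with hc_def
    set h : ℕ → ℝ := fun k => ∫ s in (0 : ℝ)..P, ∫ y, (c (k + 1) y - c k y) * K s y with hh_def
    have hcc : ∀ k, Continuous (c k) := fun k => by
      have := continuous_cutoff (a' + 2 * k)
      simpa [hc_def] using this
    have hc0 : ∀ (k : ℕ) (y : EuclideanSpace ℝ (Fin 2)), a' + 2 * (k : ℝ) + 1 < ‖y‖ → c k y = 0 := fun k y hy =>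
      Real.smoothTransition.zero_of_nonpos (by linarith [norm_le_bracket y])
    have hcd : ∀ k, Continuous fun y => c (k + 1) y - c k y := fun k => (hcc (k + 1)).sub (hcc k)
    have hcd0 : ∀ (k : ℕ) (y : EuclideanSpace ℝ (Fin 2)), a' + 2 * (k : ℝ) + 3 < ‖y‖ → c (k + 1) y - c k y = 0 := by
      intro k y hy
      rw [hc0 (k + 1) y (by push_cast; linarith), hc0 k y (by linarith), sub_zero]
    have hhc : ∀ k, Continuous fun s => ∫ y, (c (k + 1) y - c k y) * K s y := fun k => continuous_weighted hKc (hcd k) (hcd0 k)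
    have hh0 : ∀ k, 0 ≤ h k := fun k =>
      intervalIntegral.integral_nonneg hP.le fun s _ => integral_nonneg fun y =>
        mul_nonneg (sub_nonneg.2 (Real.smoothTransition.monotone (by push_cast; linarith))) (hK0 s y)
    have hsum : ∀ N, ∑ k ∈ Finset.range N, h k ≤ (3 / 2 + γhi / 2) * B * P := by
      intro N
      have hlin : ∑ k ∈ Finset.range N, h k = ∫ s in (0 : ℝ)..P, ∫ y, (c N y - c 0 y) * K s y := by
        simp only [hh_def]
        rw [← intervalIntegral.integral_finsetSum fun k _ => (hhc k).intervalIntegrable _ _]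
        refine intervalIntegral.integral_congr fun s _ => ?_
        show ∑ k ∈ Finset.range N, ∫ y, (c (k + 1) y - c k y) * K s y = ∫ y, (c N y - c 0 y) * K s y
        rw [← integral_finsetSum _ fun k _ => integrable_weighted hKc (hcd k) (hcd0 k) s]
        refine integral_congr_ae (Eventually.of_forall fun y => ?_)
        show ∑ k ∈ Finset.range N, (c (k + 1) y - c k y) * K s y = (c N y - c 0 y) * K s y
        rw [← Finset.sum_mul, Finset.sum_range_sub (fun k => c k y)]
      rw [hlin]
      have hNc : Continuous fun s => ∫ y, (c N y - c 0 y) * K s y :=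
        continuous_weighted hKc ((hcc N).sub (hcc 0)) (R := a' + 2 * N + 1) fun y hy => by
          show c N y - c 0 y = 0
          rw [hc0 N y hy, hc0 0 y (by push_cast; linarith), sub_zero]
      calc ∫ s in (0 : ℝ)..P, ∫ y, (c N y - c 0 y) * K s y
          ≤ ∫ s in (0 : ℝ)..P, (3 / 2 + γhi / 2) * B := by
            refine intervalIntegral.integral_mono_on hP.le (hNc.intervalIntegrable _ _) (by simp) fun s _ => ?_
            calc ∫ y, (c N y - c 0 y) * K s y ≤ ∫ y, K s y := by
                  refine integral_mono (integrable_weighted hKc ((hcc N).sub (hcc 0)) (R := a' + 2 * N + 1)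
                    (fun y hy => by
                      show c N y - c 0 y = 0
                      rw [hc0 N y hy, hc0 0 y (by push_cast; linarith), sub_zero]) s) (hKint s) fun y => ?_
                  have h1 : c N y - c 0 y ≤ 1 := by
                    have := Real.smoothTransition.le_one (a' + 2 * N + 1 - √(1 + ‖y‖ ^ 2))
                    have := Real.smoothTransition.nonneg (a' + 2 * (0 : ℕ) + 1 - √(1 + ‖y‖ ^ 2))
                    simp only [hc_def]; linarith
                  calc (c N y - c 0 y) * K s y ≤ 1 * K s y := mul_le_mul_of_nonneg_right h1 (hK0 s y)
                    _ = K s y := one_mul _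
              _ ≤ (3 / 2 + γhi / 2) * B := hKB s
        _ = (3 / 2 + γhi / 2) * B * P := by rw [intervalIntegral.integral_const, smul_eq_mul, sub_zero]; ring
    -- selection and conclusion: `J a' ≤ L ε` for every `ε > 0`
    have hJε : ∀ ε : ℝ, 0 < ε → J a' ≤ L * ε := by
      intro ε hε
      obtain ⟨k, hk⟩ := exists_small_weighted_term hh0 hsum ha' hε
      have hak : 0 ≤ a' + 2 * k + 1 := by positivity
      have h1 := hJmono (a' + 2 * k + 1) (by linarith [hak])
      have h2 := hJle (a' + 2 * k + 1) hak
      have h3 : (∫ s in (0 : ℝ)..P, ∫ y, (Real.smoothTransition (a' + 2 * k + 1 + 2 - √(1 + ‖y‖ ^ 2)) -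
          Real.smoothTransition (a' + 2 * k + 1 - √(1 + ‖y‖ ^ 2))) * K s y) = h k := by
        have e1 : ∀ y : EuclideanSpace ℝ (Fin 2),
            a' + 2 * (k : ℝ) + 1 + 2 - √(1 + ‖y‖ ^ 2) = a' + 2 * ((k + 1 : ℕ) : ℝ) + 1 - √(1 + ‖y‖ ^ 2) := fun y => by
          push_cast; ring
        simp only [hh_def, hc_def, e1]
      rw [h3] at h2
      have h4 : L * (a' + 2 * k + 1 + 1) * h k ≤ L * ε := by
        have : (a' + 2 * k + 1 + 1) * h k ≤ ε := by
          have := hk; ring_nf at this ⊢; exact this.le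
        calc L * (a' + 2 * k + 1 + 1) * h k = L * ((a' + 2 * k + 1 + 1) * h k) := by ring
          _ ≤ L * ε := mul_le_mul_of_nonneg_left this hL0
      linarith
    have : J a' ≤ 0 := by
      by_contra hcon
      push Not at hcon
      by_cases hL1 : L = 0
      · have := hJε 1 one_pos; rw [hL1, zero_mul] at this; linarith
      · have hLp : 0 < L := lt_of_le_of_ne hL0 (Ne.symm hL1)
        have := hJε (J a' / (2 * L)) (by positivity)
        have e : L * (J a' / (2 * L)) = J a' / 2 := by field_simp
        rw [e] at this; linarith
    exact le_antisymm this hJ0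
  -- STEP B: extraction, heights in `[0, P]`
  have stepB : ∀ s ∈ Icc (0 : ℝ) P, ∀ y, w s y = wstar := by
    intro s hs y
    set a' : ℝ := √(1 + ‖y‖ ^ 2) with ha'
    have ha'0 : 0 ≤ a' := (bracket_pos y).le
    have hJ := stepA a' ha'0
    have hjc : Continuous fun s => ∫ y', Real.smoothTransition (a' + 1 - √(1 + ‖y'‖ ^ 2)) * Dd s y' :=
      continuous_weighted hDdc (continuous_cutoff a') (cutoff_zero_of_lt a')
    have hj0 : ∀ s, 0 ≤ ∫ y', Real.smoothTransition (a' + 1 - √(1 + ‖y'‖ ^ 2)) * Dd s y' := fun s =>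
      integral_nonneg fun y' => mul_nonneg (Real.smoothTransition.nonneg _) (hDd0 s y')
    -- the height integrand vanishes on `[0, P]`
    have hjs : ∫ y', Real.smoothTransition (a' + 1 - √(1 + ‖y'‖ ^ 2)) * Dd s y' = 0 := by
      by_contra hne
      have hpos : 0 < ∫ y', Real.smoothTransition (a' + 1 - √(1 + ‖y'‖ ^ 2)) * Dd s y' := lt_of_le_of_ne (hj0 s) (Ne.symm hne)
      have hlt := intervalIntegral.integral_lt_integral_of_continuousOn_of_le_of_exists_lt (f := fun _ => (0 : ℝ)) hP
        continuousOn_const hjc.continuousOn (fun s' _ => hj0 s') ⟨s, hs, hpos⟩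
      rw [intervalIntegral.integral_zero, hJ] at hlt
      exact lt_irrefl _ hlt
    -- the horizontal integrand vanishes at `y`
    have hy1 : Real.smoothTransition (a' + 1 - √(1 + ‖y‖ ^ 2)) = 1 := profile_eq_one (by rw [ha'])
    by_contra hne
    have hne' : Real.smoothTransition (a' + 1 - √(1 + ‖y‖ ^ 2)) * Dd s y ≠ 0 := by
      rw [hy1, one_mul, hDd_def]
      exact mul_ne_zero hγlo.ne' (pow_ne_zero 2 (sub_ne_zero.2 hne))
    have hpos := Continuous.integral_pos_of_hasCompactSupport_nonneg_nonzero (μ := (volume : Measure (EuclideanSpace ℝ (Fin 2))))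
      ((continuous_cutoff a').mul (hDdc.comp (Continuous.prodMk_right s)))
      ((hasCompactSupport_of_eq_zero (cutoff_zero_of_lt a')).mul_right)
      (fun y' => mul_nonneg (Real.smoothTransition.nonneg _) (hDd0 s y')) hne'
    exact (ne_of_gt hpos) hjs
  -- STEP C: all heights, by periodicity
  intro s y
  have hper : Function.Periodic (fun s' => w s' y) P := fun s' => hPw s' y
  obtain ⟨s₀, hs₀, he⟩ := hper.exists_mem_Ico₀ hP s
  rw [he]
  exact stepB s₀ (Ico_subset_Icc_self hs₀) y

/-- **Corollary: the localised breather is frozen** — with `w ≡ w⋆` the height-evolution gives `∂ₛuᵢ ≡ 0` (and `div u = −∂ₛw = 0`,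
`curl u = 0` by hypothesis): `u` is a height-independent harmonic gradient field. [folklore] -/
theorem no_localized_breather_frozen (hu : ∀ i, ContDiff ℝ ∞ (uncurry (u i))) (hw : ContDiff ℝ ∞ (uncurry w))
    (hΘs : ContDiff ℝ ∞ Θ) (hΘ : ∀ r, HasDerivAt Θ ((r - wstar) * G r) r) (hΘ0 : Θ wstar = 0)
    (hγlo : 0 < γlo) (hGlo : ∀ r, G r ≤ -γlo) (hGhi : ∀ r, -γhi ≤ G r)
    (hus : ∀ i s y, HasDerivAt (fun s' => u i s' y) (G (w s y) * fderiv ℝ (w s) y (EuclideanSpace.single i 1)) s)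
    (hws : ∀ s y, HasDerivAt (fun s' => w s' y)
      (-(fderiv ℝ (u 0 s) y (EuclideanSpace.single 0 1) + fderiv ℝ (u 1 s) y (EuclideanSpace.single 1 1))) s)
    (hpol : ∀ s y, fderiv ℝ (u 0 s) y (EuclideanSpace.single 1 1) = fderiv ℝ (u 1 s) y (EuclideanSpace.single 0 1))
    (hP : 0 < P) (hPu : ∀ i s y, u i (s + P) y = u i s y) (hPw : ∀ s y, w (s + P) y = w s y)
    (hint : ∀ s, Integrable fun y => u 0 s y ^ 2 + u 1 s y ^ 2 + (w s y - wstar) ^ 2)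
    (hB : ∀ s, ∫ y, (u 0 s y ^ 2 + u 1 s y ^ 2 + (w s y - wstar) ^ 2) ≤ B) :
    (∀ s y, w s y = wstar) ∧ (∀ i s y, deriv (fun s' => u i s' y) s = 0) ∧
      (∀ s y, fderiv ℝ (u 0 s) y (EuclideanSpace.single 0 1) + fderiv ℝ (u 1 s) y (EuclideanSpace.single 1 1) = 0) := by
  have hconst := no_localized_breather hu hw hΘs hΘ hΘ0 hγlo hGlo hGhi hus hws hpol hP hPu hPw hint hB
  have hwc : ∀ s, w s = fun _ => wstar := fun s => funext fun y => hconst s y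
  refine ⟨hconst, fun i s y => ?_, fun s y => ?_⟩
  · rw [(hus i s y).deriv, hwc s]
    simp
  · have h := (hws s y).deriv
    have h0 : deriv (fun s' => w s' y) s = 0 := by
      have : (fun s' => w s' y) = fun _ => wstar := funext fun s' => hconst s' y
      rw [this, deriv_const]
    rw [h0] at h
    linarith

end Summit.NavierStokesRegularity.NavierStokesRegularity.Theorems.PoloidalWindowDoorPoloidalWindowRigidityZShockNoLocalizedBreather

end
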